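import Summits.Langlands.Langlands.Theses.PicardMuOrdinary
import Summits.Langlands.Langlands.Theorems.PicardMuOrdinaryIrregularClassicalityEssPolarized
import HarnessLib

/-!
# Line `slope-free-polarized-limit` — checked skeleton r14 for the crux
`Summit.Langlands.Langlands.Theses.PicardMuOrdinary.IrregularClassicality` (stmt-Langlands-13758)

Continuation lead prover-line-stmt-Langlands-13758-c16-0 (2026-08-17).  Revision r14 = the line in the UNTWISTED,
ESSENTIALLY-polarized currency.  r13 (lead c15) was closed modulo the wall W (`stub_polarizationDebt`), the honest heart
H′ (`stub_honestHeart`) and TWO Literature debts, F1 (`picardCurve_exists_lambdaAdicRep_isDeRhamFramed`, p159966) and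
F2 (`HeckeCharacter.exists_lAdic_isDeRhamFramed`, p159955: the `3`-adic avatar of an algebraic Hecke character is de
Rham above `3` — Serre 1968 III §2.3 + Conrad 2011 App. B; in-tree proof XL: local algebraicity of Weil's `weilRep` at
`v ∣ ℓ` AND Lubin–Tate periods in the constructed `B_dR`, neither present — lead c16 audit).  F2, the landed F3
(`twist_det`), `LimitTwist` (p137305) and `AlgebraicHeckeUntwist` enter r13 ONLY because W/H′ are typed with the EXACT
conjugate-self-duality `IsConjSelfDualAE c₀`: `ρ_C` has odd motivic weight (multiplier `ε⁻¹`), so it is exactly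
polarizable only after the twist by the weight-one CM character `ψ`, whose `3`-adic Hodge theory then becomes formal
debt (c15's own design remark, §5 of `Lines/slope_free_polarized_limit_audit_c15.md`).  The tree HAS the essential
currency — `AutomorphicRepData.IsGalConjEssSelfDual σ χ` (`π^σ ≅ π^∨ ⊗ (χ ∘ det)`, BLGGT §2.1 "polarized",
Fakhruddin–Pilloni §9.1; `Literature/NumberTheory/Automorphic/EssConjSelfDual.lean`) — in which `ρ_C` ITSELF is a
polarized pair and the geometric input of the heart is F1 ALONE.  So r14 has THREE stubs:

* W♮ `stub_essPolarizationDebt` (research; the wall in the untwisted currency): the crux hypothesis VERBATIM (slope-free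
  unpolarized `𝔐`-currency tower) ⇒ `e`, `ι`, `S ⊇ {v ∣ 3}`, `c₀ ≠ 1` and an ESSENTIALLY `c₀`-polarized regular algebraic
  cuspidal tower (`IsGalConjEssSelfDual c₀ χ_k`, `χ_k` Hecke characters) with Galois avatars and `ι`-adic bounds for the
  UNTWISTED traces `e(a_𝔭(f))`.  Same `3`-adic descent/accumulation wall as W (Disproof 17(a)), no `LimitTwist` in front.
* F1 `stub_picardLambdaAdicRepDeRham` (named T0 Literature debt, byte-identical with r11–r13; = the fact p159966).
* H♮ `stub_honestHeartEss` (research; the honest heart in `GU(2,1)` currency): a `3`-adically pro-automorphic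
  ESSENTIALLY-`c₀`-polarized, de Rham at `λ` (Fontaine's pinned datum), residually absolutely irreducible
  `ρ : Γ_{ℚ(ω)} → GL₃(ℚ̄₃)` is automorphic.  Identical with H′ except for the polarization clause of the tower; implied by
  Fontaine–Mazur + reciprocity exactly as H′; the Picard-modular-surface (similitude) currency, where no CM twist occurs.

Composition: the kernel-checked glue `irregularClassicality_of_essWall_of_essHeart` (this cycle; LANDED p162865, Theorems file
`PicardMuOrdinaryIrregularClassicalityEssPolarized.lean`, imported): avatar limit of the ess-polarized
tower (c14's `stub_traceLimit`), residual absolute irreducibility at `ϖ ≡ 1` (c15's R), G♮ = F1 alone, I =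
`stub_traceIdentification` (p156424), H♮, and `tr ρ(Frob⁻¹) = ι⁻¹(Σα)` (`m = 1`) — no untwist.  Closure of the typed
crux, honestly: W♮, H♮ (open problems) + F1 (Faltings `C_dR` for the Picard curve + Weil 1948; facts seat).  F2/F3 and the
twist files stay in the tree as valid theorems/facts but are no longer in the cone of this line.  Disproof used: unchanged
(byte-unchanged since 2026-08-16T05:19:32Z; its Targets still address the r1 split-ramified skeleton).
-/

open Literature.NumberTheory.GaloisRepresentations Literature.NumberTheory.Automorphic
open Literature.NumberTheory
open Literature.RepresentationTheory.Semisimple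
open scoped Pointwise NumberField
open IsDedekindDomain NumberField Polynomial Filter Topology Field

set_option linter.dupNamespace false
set_option autoImplicit false

namespace Summit.Langlands.Langlands.Cruxes.IrregularClassicality.SlopeFreePolarizedLimit

open Summit.Langlands.Langlands.Theorems.IrregularClassicality.SlopeFreePolarizedLimit

noncomputable section

/-! ## Stub W♮ (research) -/

/-- **Stub W♮ — `EssPolarizationDebt` (THE WALL in the untwisted currency; research, promoted like W).**  The crux
hypothesis VERBATIM (a slope-free unpolarized tower in `𝔐`-currency for the untwisted traces `e(a_𝔭(f))`) ⇒ `e`,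
`ι : ℚ̄₃ ≃ ℂ`, `S ⊇ {v ∣ 3}`, `c₀ ≠ 1`, and an ESSENTIALLY `c₀`-polarized (`P_k^{c₀} ≅ P_k^∨ ⊗ (χ_k ∘ det)`,
`IsGalConjEssSelfDual`, BLGGT §2.1) regular algebraic cuspidal tower WITH Galois avatars `r_k` (`IsGaloisCompatibleAt`
off `S`) and `ι`-adic bounds `‖ι⁻¹(N𝔭·ΣSat(P_k,𝔭) − e(a_𝔭))‖ ≤ 3⁻ᵏ`.  Known parts: `𝔐 ↦ ι` (`stub_placeOfMaximalIdeal`,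
p78785), avatars (named fact `exists_galoisRep_of_regularAlgebraic`).  OPEN part: `3`-adic automorphic descent /
accumulation of essentially-polarized regular eigensystems at `ρ_C` (Disproof 17(a)), i.e. W without the CM twist. -/
theorem stub_essPolarizationDebt :
    ∀ (f : Polynomial ℤ) (hcpt : Literature.NumberTheory.Automorphic.isCompact_glFiniteIntegralLevel 3 (CyclotomicField 3 ℚ)), f.natDegree = 4 → (f.map (Int.castRingHom ℚ)).Separable → 12 ∣ Nat.card (f.map (Int.castRingHom ℚ)).Gal → (∃ (e : CyclotomicField 3 ℚ →+* ℂ) (𝔐 : Ideal (integralClosure ℤ ℂ)) (S : Finset (IsDedekindDomain.HeightOneSpectrum (NumberField.RingOfIntegers (CyclotomicField 3 ℚ)))), 𝔐.IsMaximal ∧ (3 : (integralClosure ℤ ℂ)) ∈ 𝔐 ∧ ∀ k : ℕ, ∃ P : Literature.NumberTheory.Automorphic.CuspidalAutomorphicRepData 3 (CyclotomicField 3 ℚ) hcpt, P.1.IsRegularAlgebraic ∧ ∀ 𝔭 ∉ S, ∃ (α : Multiset ℂ) (t u : (integralClosure ℤ ℂ)), P.1.HasSatakeParamAt 𝔭 α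 ∧ (t : ℂ) = (𝔭.residueCard : ℂ) * α.sum - e (Literature.NumberTheory.GaloisRepresentations.picardTrace f 𝔭) ∧ u ∉ 𝔐 ∧ u * t ∈ Ideal.span {(3 : (integralClosure ℤ ℂ)) ^ k}) → ∃ (e : (CyclotomicField 3 ℚ) →+* ℂ) (ι : PadicAlgCl 3 ≃+* ℂ) (S : Finset (IsDedekindDomain.HeightOneSpectrum (NumberField.RingOfIntegers (CyclotomicField 3 ℚ)))) (c₀ : (CyclotomicField 3 ℚ) ≃ₐ[ℚ] (CyclotomicField 3 ℚ)), c₀ ≠ 1 ∧ (∀ v : IsDedekindDomain.HeightOneSpectrum (NumberField.RingOfIntegers (CyclotomicField 3 ℚ)), ((3 : ℕ) : NumberField.RingOfIntegers (CyclotomicField 3 ℚ)) ∈ v.asIdeal → v ∈ S) ∧ ∀ k : ℕ, ∃ (P : Literature.NumberTheory.Automorphic.CuspidalAutomorphicRepData 3 (CyclotomicField 3 ℚ) hcpt) (r : Literature.NumberTheory.GaloisRepresentations.FramedGaloisRep (CyclotomicField 3 ℚ) (PadicAlgCl 3) 3) (χ : Literature.NumberTheory.GaloisRepresentations.HeckeCharacter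 (CyclotomicField 3 ℚ)), P.1.IsRegularAlgebraic ∧ P.1.IsGalConjEssSelfDual c₀ χ ∧ ∀ 𝔭 ∉ S, P.1.IsUnramifiedAt 𝔭 ∧ Literature.NumberTheory.Automorphic.IsGaloisCompatibleAt P.1 ι r 𝔭 ∧ ∃ (α : Multiset ℂ) (t : (integralClosure ℤ ℂ)), P.1.HasSatakeParamAt 𝔭 α ∧ (t : ℂ) = (𝔭.residueCard : ℂ) * α.sum - e (Literature.NumberTheory.GaloisRepresentations.picardTrace f 𝔭) ∧ ‖ι.symm (t : ℂ)‖ ≤ ((3 : ℝ)⁻¹) ^ k := by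
  sorry

/-! ## Stub F1 — the Literature debt behind the geometric input (named-fact grade; byte-identical with r11–r13) -/

/-- **Stub F1 — `PicardLambdaAdicRepDeRham`**: `picardCurve_exists_lambdaAdicRep` (Upton 2009 Thm. 2.1) WITH the clause
"de Rham at every `v ∣ 3` for Fontaine's pinned datum" (Faltings 1989 / Tsuji 1999 `C_dR`; Fontaine 1994 Exp. III
Prop. 1.5.2 for the `ω`-eigenpart).  FILED as the Literature named fact `picardCurve_exists_lambdaAdicRep_isDeRhamFramed`
(p159966, ACCEPTED; T0 debt) — this stub is that fact VERBATIM (`stub_picardLambdaAdicRepDeRham_of_fact`). -/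
theorem stub_picardLambdaAdicRepDeRham :
∀ (f : ℤ[X]), f.natDegree = 4 → (f.map (Int.castRingHom ℚ)).Separable →
  ∀ (j : CyclotomicField 3 ℚ →+* PadicAlgCl 3),
    ∃ ρ : FramedGaloisRep (CyclotomicField 3 ℚ) (PadicAlgCl 3) 3,
      (∀ 𝔭 : HeightOneSpectrum (𝓞 (CyclotomicField 3 ℚ)),
          (3 : 𝓞 (CyclotomicField 3 ℚ)) ∉ 𝔭.asIdeal →
          (f.map ((Ideal.Quotient.mk 𝔭.asIdeal).comp
            (algebraMap ℤ (𝓞 (CyclotomicField 3 ℚ))))).natDegree = 4 →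
          (f.map ((Ideal.Quotient.mk 𝔭.asIdeal).comp
            (algebraMap ℤ (𝓞 (CyclotomicField 3 ℚ))))).Separable →
            ρ.IsUnramifiedAt 𝔭 ∧
            ∀ 𝔓 ∈ 𝔭.primesAbove, ∀ τ : absoluteGaloisGroup (CyclotomicField 3 ℚ),
              IsArithFrobAt (𝓞 (CyclotomicField 3 ℚ)) τ 𝔓 →
                FramedRep.trace ρ τ⁻¹ = j (picardTrace f 𝔭)) ∧
      (12 ∣ Nat.card (f.map (Int.castRingHom ℚ)).Gal → FramedRep.IsAbsolutelyIrreducible ρ) ∧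
      ∀ (v : HeightOneSpectrum (𝓞 (CyclotomicField 3 ℚ)))
        (hv : ((3 : ℕ) : 𝓞 (CyclotomicField 3 ℚ)) ∈ v.asIdeal),
        (PAdicHodge.fontainePstAdicCompletion v 3 hv).IsDeRhamFramed (ρ.toLocal v) := by
  sorry

/-- Stub F1 is VERBATIM the named fact `picardCurve_exists_lambdaAdicRep_isDeRhamFramed` (p159966). -/
theorem stub_picardLambdaAdicRepDeRham_of_fact
    (h : Literature.NumberTheory.GaloisRepresentations.picardCurve_exists_lambdaAdicRep_isDeRhamFramed) :
∀ (f : ℤ[X]), f.natDegree = 4 → (f.map (Int.castRingHom ℚ)).Separable →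
  ∀ (j : CyclotomicField 3 ℚ →+* PadicAlgCl 3),
    ∃ ρ : FramedGaloisRep (CyclotomicField 3 ℚ) (PadicAlgCl 3) 3,
      (∀ 𝔭 : HeightOneSpectrum (𝓞 (CyclotomicField 3 ℚ)),
          (3 : 𝓞 (CyclotomicField 3 ℚ)) ∉ 𝔭.asIdeal →
          (f.map ((Ideal.Quotient.mk 𝔭.asIdeal).comp
            (algebraMap ℤ (𝓞 (CyclotomicField 3 ℚ))))).natDegree = 4 →
          (f.map ((Ideal.Quotient.mk 𝔭.asIdeal).comp
            (algebraMap ℤ (𝓞 (CyclotomicField 3 ℚ))))).Separable →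
            ρ.IsUnramifiedAt 𝔭 ∧
            ∀ 𝔓 ∈ 𝔭.primesAbove, ∀ τ : absoluteGaloisGroup (CyclotomicField 3 ℚ),
              IsArithFrobAt (𝓞 (CyclotomicField 3 ℚ)) τ 𝔓 →
                FramedRep.trace ρ τ⁻¹ = j (picardTrace f 𝔭)) ∧
      (12 ∣ Nat.card (f.map (Int.castRingHom ℚ)).Gal → FramedRep.IsAbsolutelyIrreducible ρ) ∧
      ∀ (v : HeightOneSpectrum (𝓞 (CyclotomicField 3 ℚ)))
        (hv : ((3 : ℕ) : 𝓞 (CyclotomicField 3 ℚ)) ∈ v.asIdeal),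
        (PAdicHodge.fontainePstAdicCompletion v 3 hv).IsDeRhamFramed (ρ.toLocal v) :=
  h

/-! ## Stub H♮ — the honest heart in the essential (similitude) currency (research) -/

/-- **Stub H♮ — `HonestHeartEss` (OPEN).**  For `K = ℚ(ω)`, `ℓ = 3`: a framed `ρ : Γ_K → GL₃(ℚ̄₃)` that is residually
absolutely irreducible, DE RHAM at every `v ∣ 3` (Fontaine's pinned datum `PAdicHodge.fontainePstAdicCompletion`, the
clause of `Pan2022_proModularDeRhamClassical_GL2Q`), unramified off a finite `S ∋ λ`, and `3`-adically
PRO-AUTOMORPHIC-ESSENTIALLY-POLARIZED (for every `k` a regular algebraic cuspidal `P_k` on `GL₃(𝔸_K)` with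
`P_k^{c₀} ≅ P_k^∨ ⊗ (χ_k ∘ det)` for some Hecke character `χ_k` — `IsGalConjEssSelfDual c₀ χ_k`, BLGGT §2.1 — unramified
off `S` with avatar `r_k`, whose Satake sums approximate the geometric-Frobenius traces of `ρ` within `3^{-k}`) is
automorphic: a cuspidal L-algebraic `π'` whose Satake parameters give the Frobenius characteristic polynomials of `ρ`
a.e.  The `GU(2,1)/ℚ(ω)` (Picard modular surface), `p = 3` RAMIFIED, all-weights analogue of Pan's "pro-modular + de Rham
⇒ classical"; identical with H′ (`stub_honestHeart`, r10–r13) except for the polarization clause; implied by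
Fontaine–Mazur + reciprocity; not in print. -/
theorem stub_honestHeartEss :
    ∀ (hcpt : isCompact_glFiniteIntegralLevel 3 (CyclotomicField 3 ℚ)) (ι : PadicAlgCl 3 ≃+* ℂ) (c₀ : (CyclotomicField 3 ℚ) ≃ₐ[ℚ] (CyclotomicField 3 ℚ)) (S : Finset (HeightOneSpectrum (𝓞 (CyclotomicField 3 ℚ)))) (ρ : FramedGaloisRep (CyclotomicField 3 ℚ) (PadicAlgCl 3) 3), c₀ ≠ 1 → (∀ v : HeightOneSpectrum (𝓞 (CyclotomicField 3 ℚ)), ((3 : ℕ) : 𝓞 (CyclotomicField 3 ℚ)) ∈ v.asIdeal → v ∈ S) → ρ.IsResiduallyAbsIrreducible → (∀ (v : HeightOneSpectrum (𝓞 (CyclotomicField 3 ℚ))) (hv : ((3 : ℕ) : 𝓞 (CyclotomicField 3 ℚ)) ∈ v.asIdeal), (PAdicHodge.fontainePstAdicCompletion v 3 hv).IsDeRhamFramed (ρ.toLocal v)) → (∀ 𝔭 ∉ S, ρ.IsUnramifiedAt 𝔭) → (∀ k : ℕ, ∃ (P : CuspidalAutomorphicRepData 3 (CyclotomicField 3 ℚ)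 hcpt) (r : FramedGaloisRep (CyclotomicField 3 ℚ) (PadicAlgCl 3) 3) (χ : Literature.NumberTheory.GaloisRepresentations.HeckeCharacter (CyclotomicField 3 ℚ)), P.1.IsRegularAlgebraic ∧ P.1.IsGalConjEssSelfDual c₀ χ ∧ ∀ 𝔭 ∉ S, P.1.IsUnramifiedAt 𝔭 ∧ IsGaloisCompatibleAt P.1 ι r 𝔭 ∧ ∃ α : Multiset ℂ, P.1.HasSatakeParamAt 𝔭 α ∧ ∀ 𝔓 ∈ 𝔭.primesAbove, ∀ τ : absoluteGaloisGroup (CyclotomicField 3 ℚ), IsArithFrobAt (𝓞 (CyclotomicField 3 ℚ)) τ 𝔓 → ‖ι.symm ((𝔭.residueCard : ℂ) * α.sum) - FramedRep.trace ρ τ⁻¹‖ ≤ ((3 : ℝ)⁻¹) ^ k) → ∃ (π' : CuspidalAutomorphicRepData 3 (CyclotomicField 3 ℚ) hcpt) (S' : Finset (HeightOneSpectrum (𝓞 (CyclotomicField 3 ℚ)))), π'.1.IsLAlgebraic ∧ ∀ 𝔭 ∉ S', ∃ α : Multiset ℂ, π'.1.HasSatakeParamAt 𝔭 α ∧ ρ.IsUnramifiedAt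 𝔭 ∧ ρ.HasFrobCharpolyAt 𝔭 (arithFrobPolyOfSatake ι 𝔭.residueCard 1 α) := by
  sorry


/-! ## The composition: W♮, F1, H♮ imply the crux, by name -/

/-- **The line concludes the crux** (the only `sorry`s are inside W♮, F1, H♮): the LANDED glue
`irregularClassicality_of_essWall_of_essHeart` (p162865) fed with the three stubs. -/
theorem IrregularClassicality_of :
    Summit.Langlands.Langlands.Theses.PicardMuOrdinary.IrregularClassicality :=
  Summit.Langlands.Langlands.Theorems.IrregularClassicality.SlopeFreePolarizedLimit.irregularClassicality_of_essWall_of_essHeart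
    stub_essPolarizationDebt stub_picardLambdaAdicRepDeRham stub_honestHeartEss

end

end Summit.Langlands.Langlands.Cruxes.IrregularClassicality.SlopeFreePolarizedLimit
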